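import Literature.MathematicalPhysics.QuantumFieldTheory.Balaban1983to89.B9SectBCodedChainL2
import Literature.MathematicalPhysics.QuantumFieldTheory.Balaban1983to89.B9SectBL2StepCodedOn
import Literature.MathematicalPhysics.QuantumFieldTheory.Balaban1983to89.B9SectBStepL2FamilyTransferPos

/-!
# `Balaban1983to89.B9SectBL2StepRecordOn` — ★★★ the POSITIVE-INPUT (3.46) BLOCK-STEP `StepL2Pos` OF THE RECORD's OWN FAMILY on a subfamily, from the
# coded family `KSC₃`'s (`B9SectBL2StepCodedOn`) by the Step-level input/output dominations of the `L²` member and the coded-carrier pullback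
# (pub-ymgap N06 row 13, (O4) per-member programme, `L²` member — the object the certificate's `sectBStepPrinted_of_posBlockSteps` consumes)

T. Bałaban, *Propagators for lattice gauge theories in a background field*, Commun. Math. Phys. **99** (1985) 389–434
[`Balaban1985BackgroundPropagators`, "B9"]; [4] = T. Bałaban, *Propagators and renormalization transformations for lattice gauge
theories. II*, Commun. Math. Phys. **96** (1984) 223–250 [`Balaban1984PropagatorsII`].

statement-level skeleton of published theorems with citation tags; proofs where landed; nothing here is a claim about the
Yang–Mills mass gap

THE PRINTED LOCI.  Theorem 3.1 (3.46) p. 398; Theorem 3.4 p. 400, Sect. B pp. 400–407; p. 398 first remark; p. 403 l.1–9; p. 404 after (3.69) (plaquette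
smallness); [4] Lemma 2.1 p. 234, Prop. 2.6 p. 247.

WHY THIS FILE (seat dag-n06-c gen 9; chain owner dag-n06-d g10's interface word «StepPos currency», 2026-08-28).  §1 `hin` with EXPLICIT positive
constants (g7's `thms_KSC_base_of_pullK` ∘ `B9SectBCodedChainL2.thms_KSC₃_base_of_KSC₂` ∘ `B9SectBL2SecondOrderY.l2Block_KSC₃_base_of_record`);
§2 the `L²` output domination at `U′U` (`B9SectBL2SecondOrderY.l2Block_record_at_W_of_KSC₃'`, read along the decoding); §3 ★★★ `stepL2Pos_record_on`:
`StepL2Pos` of the record's `kernelFamilyS … (GpY par) par` over `bg9Y` from `stepL2Pos_KSC₃_on` by `stepL2Pos_of_family_pos` and `stepL2Pos_of_coded`.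
Displayed: the plaquette law of the (3.35)-regular bases (`hplaq`), the class implication (`hclass`, discharged for `C37Y` in `B9SectBCodedChainC37Y`),
and the structural data of the frames (`hpar`, `hunit`, thresholds).
Value = the row-13 `L²` block-step in the certificate's currency; NOT summit progress; N06 is not discharged by this file.
-/

noncomputable section

namespace Literature.MathematicalPhysics.QuantumFieldTheory.Balaban1983to89.B9SectBL2StepRecordOn

open Literature.MathematicalPhysics.QuantumFieldTheory.Balaban1983to89
open Literature.MathematicalPhysics.QuantumFieldTheory.Balaban1983to89.B6Ineq2142KLevelV1 (β)
open Literature.MathematicalPhysics.QuantumFieldTheory.Balaban1983to89.B9FromB6 (L2Block)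
open Literature.MathematicalPhysics.QuantumFieldTheory.Balaban1983to89.B9Eq39Adjoint (fluct)
open Literature.MathematicalPhysics.QuantumFieldTheory.Balaban1983to89.B9SectBCodedCarrier (CCfg Coding pullK pullS)
open Literature.MathematicalPhysics.QuantumFieldTheory.Balaban1983to89.B9Eq360DeltaPrimeAY (AfldY mulY)
open Literature.MathematicalPhysics.QuantumFieldTheory.Balaban1983to89.B9PinMembersKLevelV1 (MemberY geo9Y bg9Y)
open Literature.MathematicalPhysics.QuantumFieldTheory.Balaban1983to89.B9SectBGpLettersY (GVal)
open Literature.MathematicalPhysics.QuantumFieldTheory.Balaban1983to89.B9SectBGpFrameCodedY (codingYx CplxLettersY)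
open Literature.MathematicalPhysics.QuantumFieldTheory.Balaban1983to89.B9SectBGpReadingsY (KSC)
open Literature.MathematicalPhysics.QuantumFieldTheory.Balaban1983to89.B9SectBGpTransferInY (thms_KSC_base_of_pullK)
open Literature.MathematicalPhysics.QuantumFieldTheory.Balaban1983to89.B9SectBCodedChainGlob (KSC₂ thms_KSC₂_base_iff)
open Literature.MathematicalPhysics.QuantumFieldTheory.Balaban1983to89.B9SectBL2DictionaryY (KSC₃)
open Literature.MathematicalPhysics.QuantumFieldTheory.Balaban1983to89.B9SectBL2SecondOrderY (PlaqLawY l2Block_KSC₃_base_of_record l2Block_record_at_W_of_KSC₃'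
  convConst2L2 convConst2L2_nonneg cross2ConstL2 cross2ConstL2_nonneg)
open Literature.MathematicalPhysics.QuantumFieldTheory.Balaban1983to89.B9SectBL2TransferInY (crossConstL2 crossConstL2_nonneg)
open Literature.MathematicalPhysics.QuantumFieldTheory.Balaban1983to89.B9SectBCodedChainL2 (exists_thresholds_L2 thms_KSC₃_base_of_KSC₂ thms_mono_B₀ l2Block_max_zero
  l2Block_weaken)
open Literature.MathematicalPhysics.QuantumFieldTheory.Balaban1983to89.B9SectBL2StepCodedOn (stepL2Pos_KSC₃_on)
open Literature.MathematicalPhysics.QuantumFieldTheory.Balaban1983to89.B9SectBStepL2FamilyTransferPos (stepL2Pos_of_family_pos stepL2Pos_of_coded)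
open Literature.MathematicalPhysics.QuantumFieldTheory.Balaban1983to89.B9SectBStepWhole (StepL2Pos)
open Literature.MathematicalPhysics.QuantumFieldTheory.Balaban1983to89.B9GeoNbrCountKLevelV1 (exists_card_nbr_geo9Y_le_of_M)
open Literature.MathematicalPhysics.QuantumFieldTheory.Balaban1983to89.Node00 (SiteY BlkY IBondY CfgY SiteParY kernelFamilyS GpY)

variable {d ℓ : ℕ} {hd : 1 ≤ d + 1} {hL : Odd (ℓ + 1) ∧ 1 < ℓ + 1} {b₀ b₁ : ℝ} {Mstar : ℕ}
variable {𝔸 : Type} [NormedRing 𝔸] [NormedAlgebra ℂ 𝔸] [CompleteSpace 𝔸] [NormOneClass 𝔸] [FiniteDimensional ℝ 𝔸]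

variable {J : Type} (f : J → MemberY d ℓ hd hL b₀ b₁ Mstar) [∀ x : MemberY d ℓ hd hL b₀ b₁ Mstar, Fintype (geo9Y x).Site]
  [∀ x : MemberY d ℓ hd hL b₀ b₁ Mstar, DecidableEq (geo9Y x).Site] [∀ x : MemberY d ℓ hd hL b₀ b₁ Mstar, Nonempty (geo9Y x).Site]
  (c35 : ℝ) (G : Subgroup 𝔸ˣ) (par : ∀ j : J, SiteParY 𝔸 (f j).toKIdx) {ι : Type} [Fintype ι] [DecidableEq ι] (b : Module.Basis ι ℝ 𝔸)
  (ιB : ∀ j : J, BlkY (f j).toKIdx → IBondY (f j).toKIdx)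
  (C37 C38 : ∀ j : J, ℝ → CfgY 𝔸 (f j).toKIdx → AfldY 𝔸 (f j).toKIdx → Prop)

/-! ## §1  The input domination with explicit positive constants -/

omit [NormOneClass 𝔸] [∀ x : MemberY d ℓ hd hL b₀ b₁ Mstar, Nonempty (geo9Y x).Site] in
/-- ★ **`hin` FOR `KSC₃` WITH POSITIVE OUTPUT CONSTANTS** (input rate `δ₀ > 0`): at every (3.35)-regular base above the thresholds, the record family's
Theorem-3.1–3.3 block (read along the decoding) with constants `(B₀, δ₀, B_β, B_ε, B_εβ, B₁, δ₁)` gives `KSC₃`'s with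
`(max(c_in·max(B₀,0), 1) ∨ c_L·max(cross…)(max B₀ 0), δ₀/2, B_β, B_ε, B_εβ, B₁, δ₁)` — g7's (3.42) conversion (`thms_KSC_base_of_pullK`, neighbour count), the
augmented (3.46) member by `l2Block_KSC₃_base_of_record` under the plaquette law `hplaq`.
[cite: Balaban1985BackgroundPropagators, Thms 3.1–3.3 (3.42)–(3.48) pp.397–399, (3.35) p.396, p.398 (first remark); Balaban1984PropagatorsII, Lemma 2.1 p.234] -/
theorem hin_KSC₃_on_explicit (hι : ∀ (j : J) (s : BlkY (f j).toKIdx), β (f j).toKIdx.hN (f j).toKIdx.D (f j).toKIdx.hk (ιB j s) = s)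
    (hG1 : ∀ u : 𝔸ˣ, u ∈ G → ‖(u : 𝔸)‖ ≤ 1) {M₂ : ℝ} (hM₂ : 0 ≤ M₂) (hrepr : ∀ (v : 𝔸) (j : ι), |b.repr v j| ≤ M₂ * ‖v‖) (dC : ℕ)
    (GA : ∀ j : J, B9.KernelFamily (geo9Y (f j)) (codingYx G (f j) (C37 j) (C38 j)).bg)
    (Cinv : ∀ j : J, B9.SiteKernel (geo9Y (f j)) (codingYx G (f j) (C37 j) (C38 j)).bg)
    (hGA : ∀ (j : J) (c : (codingYx G (f j) (C37 j) (C38 j)).bg.Cfg),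
      (∀ lam β' ζ, 0 ≤ (GA j).h1 c lam β' ζ) ∧ (∀ lam y, 0 ≤ (GA j).e4 c lam y) ∧ (∀ lam β' ζ, 0 ≤ (GA j).h2 c lam β' ζ))
    {cP : ℝ} (hcP : 0 ≤ cP)
    (hplaq : ∀ (j : J) (α₀ : ℝ) (U : CfgY 𝔸 (f j).toKIdx), (bg9Y 𝔸 G (f j)).Reg335 c35 α₀ U → PlaqLawY (f j) (ιB j) cP U) :
    ∀ (B₀ δ₀ : ℝ) (Bβ Bε : ℝ → ℝ) (Bεβ : ℝ → ℝ → ℝ) (B₁ δ₁ : ℝ), 0 < B₀ → 0 < δ₀ → 0 < B₁ → 0 < δ₁ →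
      ∃ (Mi ai B₀' δ₀' : ℝ) (Bβ' Bε' : ℝ → ℝ) (Bεβ' : ℝ → ℝ → ℝ) (B₁' δ₁' : ℝ), 0 < ai ∧ 0 < B₀' ∧ 0 < δ₀' ∧ 0 < B₁' ∧ 0 < δ₁' ∧
        ∀ j : J, Mi ≤ (geo9Y (f j)).M → ∀ α₀ : ℝ, 0 < α₀ → (geo9Y (f j)).M * α₀ ≤ ai →
          ∀ c : (codingYx G (f j) (C37 j) (C38 j)).bg.Cfg, (codingYx G (f j) (C37 j) (C38 j)).bg.Reg335 c35 α₀ c →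
          B9.Thms31to33IneqAt dC (pullK (codingYx G (f j) (C37 j) (C38 j))
              (kernelFamilyS (f j).toKIdx (bg9Y 𝔸 G (f j)) (fun U => U) (GpY (f j).toKIdx (par j)) (par j))) (GA j) (Cinv j) B₀ δ₀ Bβ Bε Bεβ B₁ δ₁ c →
          B9.Thms31to33IneqAt dC (KSC₃ G (f j) (par j) (C37 j) (C38 j)) (GA j) (Cinv j) B₀' δ₀' Bβ' Bε' Bεβ' B₁' δ₁' c := by
  intro B₀ δ₀ Bβ Bε Bεβ B₁ δ₁ hB₀ hδ₀ hB₁ hδ₁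
  obtain ⟨ML, mN, hcnt⟩ := exists_card_nbr_geo9Y_le_of_M (d := d) (ℓ := ℓ) (hd := hd) (hL := hL) (b₀ := b₀) (b₁ := b₁) (2 * ((d : ℝ) + 1))
  obtain ⟨d261, Mthr, hthr⟩ := exists_thresholds_L2 f
  set cIn : ℝ := ((ℓ + 1 : ℕ) : ℝ) * Real.exp (|δ₀| * (2 * ((d : ℝ) + 1))) + ((mN : ℝ) * (M₂ * ∑ j, ‖b j‖) * Real.exp (|δ₀| * (2 * ((d : ℝ) + 1))) + 1)
    with hcIn
  set Sb : ℝ := ∑ j, ‖b j‖ with hSb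
  set sι : ℝ := Real.sqrt (Fintype.card ι) with hsι
  set Λ : ℝ := ((ℓ : ℝ) + 1) ^ 4 with hΛ
  set BL : ℝ := (sι * M₂ * Sb) * max (crossConstL2 M₂ Sb sι d (d261 δ₀) δ₀ Λ (max B₀ 0)) (cross2ConstL2 cP M₂ Sb sι d (d261 δ₀) δ₀ Λ (max B₀ 0))
    with hBL
  have hΛ1 : 1 ≤ Λ := one_le_pow₀ (by linarith [(Nat.cast_nonneg ℓ : (0 : ℝ) ≤ ℓ)])
  have hSb0 : 0 ≤ Sb := Finset.sum_nonneg fun j _ => norm_nonneg _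
  have hsι0 : 0 ≤ sι := Real.sqrt_nonneg _
  have hBL0 : 0 ≤ BL := by
    have := crossConstL2_nonneg hM₂ hSb0 hsι0 d (d261 δ₀) δ₀ Λ (le_max_right B₀ 0)
    rw [hBL]; exact mul_nonneg (by positivity) (le_max_of_le_left this)
  refine ⟨max (max ML (2 * ((d : ℝ) + 1) + 1)) (Mthr δ₀), 1, max (max (cIn * max B₀ 0) 1) BL, min δ₀ (δ₀ / 2), Bβ, Bε, Bεβ, B₁, δ₁, one_pos,
    lt_max_of_lt_left (lt_max_of_lt_right one_pos), lt_min hδ₀ (half_pos hδ₀), hB₁, hδ₁, fun j hM α₀ hα₀ hMa c hreg hT => ?_⟩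
  obtain ⟨U, rfl, hU335⟩ := (codingYx G (f j) (C37 j) (C38 j)).exists_of_bg_Reg335 hreg
  have hU : GVal G (f j).toKIdx U := hU335.1.1
  have hM2 : 2 * ((d : ℝ) + 1) < (geo9Y (f j)).M := by
    have := le_trans (le_max_right _ _) (le_trans (le_max_left _ _) hM); linarith
  have hML : ML ≤ (geo9Y (f j)).M := le_trans (le_max_left _ _) (le_trans (le_max_left _ _) hM)
  have hMt : Mthr δ₀ ≤ (geo9Y (f j)).M := le_trans (le_max_right _ _) hM
  obtain ⟨h261, hT1, -, -, hTi2⟩ := hthr j δ₀ hδ₀ hMt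
  -- the (3.42)–(3.45), (3.47) members: g7's conversion at the base (`KSC`), = `KSC₂`'s at a base
  have hK : B9.Thms31to33IneqAt dC (KSC G (f j) (par j) (C37 j) (C38 j)) (GA j) (Cinv j) (cIn * max B₀ 0) δ₀ Bβ Bε Bεβ B₁ δ₁ (.base U) :=
    thms_KSC_base_of_pullK G (f j) (par j) b (ιB j) (C37 j) (C38 j) (hι j) hG1 hU hM₂ hrepr hM2 (fun a => hcnt Mstar (f j) hML a) dC (GA j) (Cinv j) hT
  have hK2 : B9.Thms31to33IneqAt dC (KSC₂ G (f j) (par j) (C37 j) (C38 j)) (GA j) (Cinv j) (max (cIn * max B₀ 0) 1) δ₀ Bβ Bε Bεβ B₁ δ₁ (.base U) :=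
    thms_mono_B₀ G (f j) (C37 j) (C38 j) dC _ (GA j) (Cinv j) (le_max_left _ _)
      ((thms_KSC₂_base_iff G (f j) (par j) (C37 j) (C38 j) dC (GA j) (Cinv j) _ δ₀ Bβ Bε Bεβ B₁ δ₁ U).2 hK)
  -- the augmented (3.46) member from the record's block at `U`
  have hL2 : L2Block (kernelFamilyS (f j).toKIdx (bg9Y 𝔸 G (f j)) (fun U => U) (GpY (f j).toKIdx (par j)) (par j)) (max B₀ 0) δ₀ U :=
    l2Block_max_zero (f j) _ fun n lam hh y y' hc hs => hT.1.1.2.1 n lam hh y y' hc hs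
  have hK3 := l2Block_KSC₃_base_of_record G (f j) (par j) b (ιB j) (C37 j) (C38 j) (hι j) hG1 hM₂ hrepr hδ₀ h261 hΛ1 hT1 hTi2 hcP (le_max_right B₀ 0)
    hU (hplaq j α₀ U hU335) hL2
  have h := thms_KSC₃_base_of_KSC₂ G (f j) (par j) (C37 j) (C38 j) dC (GA j) (Cinv j) (le_trans zero_le_one (le_max_right _ _)) (hGA j _).1 (hGA j _).2.1
    (hGA j _).2.2 hK2 hBL0 (by rw [hBL, hSb, hsι]; exact hK3)
  exact h

/-! ## §2  The `L²` output domination at `U′U` -/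

omit [∀ x : MemberY d ℓ hd hL b₀ b₁ Mstar, Nonempty (geo9Y x).Site] in
/-- ★ **THE `L²` OUTPUT DOMINATION AT `U′U`**: for `(B, δ) > 0` and a cap `a`, above `Mthr δ` and for `α₁ ≦ min a (1/4)`, `KSC₃`'s (3.46) block at the product
gives the record family's (read along the decoding) with `(max (c_L·convConst2L2(B)) 1, δ/2)` — `B9SectBL2SecondOrderY.l2Block_record_at_W_of_KSC₃'` under the
plaquette law of the regular base. [cite: Balaban1985BackgroundPropagators, p.403 l.1–9, (3.46) p.398, (3.70) p.404, (3.74) p.405, p.404 (after (3.69))] -/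
theorem houtL2_KSC₃_on (hι : ∀ (j : J) (s : BlkY (f j).toKIdx), β (f j).toKIdx.hN (f j).toKIdx.D (f j).toKIdx.hk (ιB j s) = s)
    (hG1 : ∀ u : 𝔸ˣ, u ∈ G → ‖(u : 𝔸)‖ ≤ 1) {M₂ : ℝ} (hM₂ : 0 ≤ M₂) (hrepr : ∀ (v : 𝔸) (j : ι), |b.repr v j| ≤ M₂ * ‖v‖)
    {Cq : ℝ} (hC37 : ∀ j β' U a, C37 j β' U a → GVal G (f j).toKIdx U ∧ CplxLettersY G (f j) (par j) (ιB j) Cq β' U a)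
    {cP : ℝ} (hcP : 0 ≤ cP)
    (hplaq : ∀ (j : J) (α₀ : ℝ) (U : CfgY 𝔸 (f j).toKIdx), (bg9Y 𝔸 G (f j)).Reg335 c35 α₀ U → PlaqLawY (f j) (ιB j) cP U) :
    ∀ (B δ a : ℝ), 0 < B → 0 < δ → 0 < a →
      ∃ (Mo ao a' B' δ' : ℝ), 0 < ao ∧ 0 < a' ∧ a' ≤ a ∧ 0 < B' ∧ 0 < δ' ∧
        ∀ j : J, Mo ≤ (geo9Y (f j)).M → ∀ α₀ : ℝ, 0 < α₀ → (geo9Y (f j)).M * α₀ ≤ ao →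
          ∀ c : (codingYx G (f j) (C37 j) (C38 j)).bg.Cfg, (codingYx G (f j) (C37 j) (C38 j)).bg.Reg335 c35 α₀ c →
          ∀ α₁ : ℝ, 0 < α₁ → α₁ ≤ a' → ∀ c' : (codingYx G (f j) (C37 j) (C38 j)).bg.Cfg, (codingYx G (f j) (C37 j) (C38 j)).bg.Cplx337 α₁ c c' →
          L2Block (KSC₃ G (f j) (par j) (C37 j) (C38 j)) B δ ((codingYx G (f j) (C37 j) (C38 j)).bg.mul c' c) →
          L2Block (pullK (codingYx G (f j) (C37 j) (C38 j))
            (kernelFamilyS (f j).toKIdx (bg9Y 𝔸 G (f j)) (fun U => U) (GpY (f j).toKIdx (par j)) (par j))) B' δ' ((codingYx G (f j) (C37 j) (C38 j)).bg.mul c' c) := by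
  intro B δ a hB hδ ha
  obtain ⟨d261, Mthr, hthr⟩ := exists_thresholds_L2 f
  set Sb : ℝ := ∑ j, ‖b j‖ with hSb
  set sι : ℝ := Real.sqrt (Fintype.card ι) with hsι
  set Λ : ℝ := ((ℓ : ℝ) + 1) ^ 4 with hΛ
  set B'' : ℝ := (sι * M₂ * Sb) * convConst2L2 cP M₂ Sb sι d (d261 δ) δ Λ B with hB''
  have hΛ0 : 0 ≤ Λ := by positivity
  have hSb0 : 0 ≤ Sb := Finset.sum_nonneg fun j _ => norm_nonneg _
  have hsι0 : 0 ≤ sι := Real.sqrt_nonneg _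
  have hB''0 : 0 ≤ B'' := by
    have := (convConst2L2_nonneg (dL := d261 δ) (δ₀ := δ) hcP hM₂ hSb0 hsι0 d hΛ0 hB.le).2.2.2
    rw [hB'']; exact mul_nonneg (by positivity) this
  refine ⟨Mthr δ, 1, min a (1 / 4), max B'' 1, δ / 2, one_pos, lt_min ha (by norm_num), min_le_left _ _, lt_max_of_lt_right one_pos, half_pos hδ,
    fun j hM α₀ hα₀ hMa c hreg α₁ hα₁ hα₁a c' h37 hL => ?_⟩
  obtain ⟨h261, hT1, hT2, hTi, hTi2⟩ := hthr j δ hδ hM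
  obtain ⟨U, a', rfl, rfl, hC⟩ := (codingYx G (f j) (C37 j) (C38 j)).exists_of_bg_Cplx337 h37
  have hα₁c : α₁ ≤ 1 / 4 := hα₁a.trans (min_le_right _ _)
  have hU335 : (bg9Y 𝔸 G (f j)).Reg335 c35 α₀ U := hreg
  have hconv := l2Block_record_at_W_of_KSC₃' G (f j) (par j) b (ιB j) (C37 j) (C38 j) (hι j) hG1 hM₂ hrepr (hC37 j) hδ h261 hΛ0 hT1 hT2 hTi hTi2
    hcP hB.le hα₁c hC (hplaq j α₀ U hU335) hL
  intro n lam hh y y' hc hs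
  have h := l2Block_weaken (f j) _ hB''0 (le_max_left B'' 1) (le_refl (δ / 2)) (by rw [hB'', hSb, hsι]; exact hconv) n lam hh y y' hc hs
  exact h

/-! ## §3  ★★★ The positive-input (3.46) block-step of the record family on a subfamily -/

/-- ★★★ **`StepL2Pos` OF THE RECORD FAMILY ON A SUBFAMILY** (input families: the record's `kernelFamilyS … (GpY par) par`, `GA`, `Cinv` over `bg9Y`; output:
the record's (3.46) block at `U′U`): from `B9SectBL2StepCodedOn.stepL2Pos_KSC₃_on` by `stepL2Pos_of_family_pos` (§1, §2) and `stepL2Pos_of_coded`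
(class implication `hclass`).  Displayed: `hplaq` (plaquette law of the regular bases), `hclass`, the frames' structural data.
[cite: Balaban1985BackgroundPropagators, Thm 3.1 (3.46) p.398, Thm 3.4 p.400, Sect. B pp.400–407, p.403 l.1–9, p.398 (first remark), p.404 (after (3.69)); Balaban1984PropagatorsII, Lemma 2.1 p.234, Prop. 2.6 p.247] -/
theorem stepL2Pos_record_on (hι : ∀ (j : J) (s : BlkY (f j).toKIdx), β (f j).toKIdx.hN (f j).toKIdx.D (f j).toKIdx.hk (ιB j s) = s)
    (hG1 : ∀ u : 𝔸ˣ, u ∈ G → ‖(u : 𝔸)‖ ≤ 1) (hpar : ∀ j (U : CfgY 𝔸 (f j).toKIdx), GVal G (f j).toKIdx U → ∀ z w, par j U z w ∈ G)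
    (hunit : ∀ j (U : CfgY 𝔸 (f j).toKIdx), GVal G (f j).toKIdx U → IsUnit (Node00.deltaPrimeAY (f j).toKIdx (par j) U))
    (dB : ℕ) (M₂ : ℝ) (hM₂ : 0 ≤ M₂) (hrepr : ∀ (v : 𝔸) (j : ι), |b.repr v j| ≤ M₂ * ‖v‖) (hcR : 0 < M₂ * ∑ j, ‖b j‖)
    (hcL : 0 < Real.sqrt (Fintype.card ι) * M₂ * ∑ j, ‖b j‖)
    (Cq : ℝ) (hCq : 0 ≤ Cq) (hC37 : ∀ j β' U a, C37 j β' U a → GVal G (f j).toKIdx U ∧ CplxLettersY G (f j) (par j) (ιB j) Cq β' U a)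
    (MInv aInv aW : ℝ) (hMInv : 0 < MInv) (haInv : 0 < aInv) (haW : 0 < aW)
    (GA : ∀ j : J, B9.KernelFamily (geo9Y (f j)) (bg9Y 𝔸 G (f j))) (Cinv : ∀ j : J, B9.SiteKernel (geo9Y (f j)) (bg9Y 𝔸 G (f j)))
    (hGA : ∀ (j : J) (U : (bg9Y 𝔸 G (f j)).Cfg),
      (∀ lam β' ζ, 0 ≤ (GA j).h1 U lam β' ζ) ∧ (∀ lam y, 0 ≤ (GA j).e4 U lam y) ∧ (∀ lam β' ζ, 0 ≤ (GA j).h2 U lam β' ζ))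
    {cP : ℝ} (hcP : 0 ≤ cP)
    (hplaq : ∀ (j : J) (α₀ : ℝ) (U : CfgY 𝔸 (f j).toKIdx), (bg9Y 𝔸 G (f j)).Reg335 c35 α₀ U → PlaqLawY (f j) (ιB j) cP U)
    {r αcap Mc ac : ℝ} (hr : 0 < r) (hcap : 0 < αcap) (hac : 0 < ac)
    (hclass : ∀ (j : J) (α₀ α₁ : ℝ) (U U' : (bg9Y 𝔸 G (f j)).Cfg), Mc ≤ (geo9Y (f j)).M → 0 < α₀ → (geo9Y (f j)).M * α₀ ≤ ac →
      (bg9Y 𝔸 G (f j)).Reg335 c35 α₀ U → 0 < α₁ → α₁ ≤ αcap → (bg9Y 𝔸 G (f j)).Cplx337 α₁ U U' →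
      ∃ a : (codingYx G (f j) (C37 j) (C38 j)).A,
        (codingYx G (f j) (C37 j) (C38 j)).decA a = U' ∧ (codingYx G (f j) (C37 j) (C38 j)).C37 (r * α₁) U a) :
    StepL2Pos dB c35 (fun j => geo9Y (f j)) (fun j => bg9Y 𝔸 G (f j))
      (fun j => kernelFamilyS (f j).toKIdx (bg9Y 𝔸 G (f j)) (fun U => U) (GpY (f j).toKIdx (par j)) (par j)) GA Cinv
      (fun j => kernelFamilyS (f j).toKIdx (bg9Y 𝔸 G (f j)) (fun U => U) (GpY (f j).toKIdx (par j)) (par j)) := by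
  have hGA' : ∀ (j : J) (c : (codingYx G (f j) (C37 j) (C38 j)).bg.Cfg),
      (∀ lam β' ζ, 0 ≤ (pullK (codingYx G (f j) (C37 j) (C38 j)) (GA j)).h1 c lam β' ζ) ∧
      (∀ lam y, 0 ≤ (pullK (codingYx G (f j) (C37 j) (C38 j)) (GA j)).e4 c lam y) ∧
      (∀ lam β' ζ, 0 ≤ (pullK (codingYx G (f j) (C37 j) (C38 j)) (GA j)).h2 c lam β' ζ) := fun j c => hGA j _
  refine stepL2Pos_of_coded dB c35 (fun j => geo9Y (f j)) (fun j => bg9Y 𝔸 G (f j))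
    (fun j => kernelFamilyS (f j).toKIdx (bg9Y 𝔸 G (f j)) (fun U => U) (GpY (f j).toKIdx (par j)) (par j)) GA Cinv
    (fun j => codingYx G (f j) (C37 j) (C38 j)) _ hr hcap hac hclass ?_
  exact stepL2Pos_of_family_pos dB c35 (fun j => geo9Y (f j)) (fun j => (codingYx G (f j) (C37 j) (C38 j)).bg)
    (fun j => KSC₃ G (f j) (par j) (C37 j) (C38 j))
    (fun j => pullK (codingYx G (f j) (C37 j) (C38 j)) (kernelFamilyS (f j).toKIdx (bg9Y 𝔸 G (f j)) (fun U => U) (GpY (f j).toKIdx (par j)) (par j)))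
    (fun j => pullK (codingYx G (f j) (C37 j) (C38 j)) (GA j)) (fun j => pullK (codingYx G (f j) (C37 j) (C38 j)) (GA j))
    (fun j => KSC₃ G (f j) (par j) (C37 j) (C38 j))
    (fun j => pullK (codingYx G (f j) (C37 j) (C38 j)) (kernelFamilyS (f j).toKIdx (bg9Y 𝔸 G (f j)) (fun U => U) (GpY (f j).toKIdx (par j)) (par j)))
    (fun j => pullS (codingYx G (f j) (C37 j) (C38 j)) (Cinv j))
    (hin_KSC₃_on_explicit f c35 G par b ιB C37 C38 hι hG1 hM₂ hrepr dB _ _ hGA' hcP hplaq)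
    (houtL2_KSC₃_on f c35 G par b ιB C37 C38 hι hG1 hM₂ hrepr hC37 hcP hplaq)
    (stepL2Pos_KSC₃_on f c35 G b C37 C38 par ιB hι hG1 hpar hunit dB M₂ hM₂ hrepr hcR hcL Cq hCq hC37 MInv aInv aW hMInv haInv haW _ _)

end Literature.MathematicalPhysics.QuantumFieldTheory.Balaban1983to89.B9SectBL2StepRecordOn

end
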